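import Literature.NumberTheory.DiophantineApproximation.DilogHermitePade
import Mathlib.Analysis.SpecificLimits.Basic
import HarnessLib

/-!
# The Hermite–Padé form at `x = 1/N` as `a_n Li₂(1/N) + b_n Li₁(1/N) + c_n`

Topic `Literature/NumberTheory/DiophantineApproximation`. For the type-I Hermite–Padé form
`S_n(x) = ∑_{t ≥ 1} R_n(t) x^t` of `DilogHermitePade.lean` (`DilogPade.form`), the partial fraction
expansion `R_n(t) = ∑_{i=0}^{n} (A_{n,i}/(t+i)² + B_{n,i}/(t+i))` of the kernel (proved in the
sibling file `DilogHermitePadePartialFractions.lean`; here it is the HYPOTHESIS `hPF`) turns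
`S_n(1/N)` into `a_n L₂ + b_n L₁ + c_n`, where `L_s = ∑_{k ≥ 1} N^{-k}/k^s`
(`DilogPade.polylogSeries s (1/N)`; `L₁ = −log(1 − 1/N)`, `L₂ = Li₂(1/N)`) and
`a_n = formA n N ∈ ℤ`, `b_n = formB n N ∈ ℚ`, `c_n = formC n N ∈ ℚ`.

* `summable_pow_div_shift`, `summable_polylogSeries` — the series `∑_t x^{t+1}/(t+1+i)^s`
  converge for `0 ≤ x < 1` (comparison with the geometric series);
* `pow_mul_tsum_shift` — `x^i ∑_{t ≥ 0} x^{t+1}/(t+1+i)^s = L_s(x) − ∑_{k<i} x^{k+1}/(k+1)^s`;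
* `form_eq_of_partialFractions` — `S_n(1/N) = a_n L₂(1/N) + b_n L₁(1/N) + c_n` for `N ≥ 2`.

The computation: `∑_{t ≥ 0} x^{t+1}/(t+1+i)^s = N^i (L_s − ∑_{k<i} x^{k+1}/(k+1)^s)` at `x = 1/N`
(reindex `k = t + i`, `x^i N^i = 1`), and in the finite remainder `N^i x^{k+1} = N^{i−1−k}`, so
the substitution `k ↦ i − 1 − k` produces the double sum defining `formC`.

References: S. David, N. Hirata-Kohno, M. Kawashima, *Can polylogarithms at algebraic points be
linearly independent?*, Moscow J. Comb. Number Th. 9 (2020), Thm 2.1 (the series identity behind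
the Padé construction); M. Hata, *On the linear independence of the values of polylogarithmic
functions*, J. Math. Pures Appl. 69 (1990). Everything here is PROVED from Mathlib's `tsum` API;
no definitions, no named facts. The partial fractions themselves, the bounds `0 < S_n(1/N) ≤ N^{-2n}`
and the arithmetic of `a_n, b_n, c_n` are NOT here (sibling files).
-/

noncomputable section

open Finset

namespace Literature.NumberTheory.DiophantineApproximation

namespace DilogPade

/-- Summability of the shifted polylogarithm-type series `∑_t x^{t+1}/(t+1+i)^s` for
`0 ≤ x < 1`: its terms are nonnegative and at most `x^{t+1}` (the denominators are `≥ 1`),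
so it is dominated by the geometric series. [folklore] -/
theorem summable_pow_div_shift (s i : ℕ) {x : ℝ} (hx : 0 ≤ x) (hx1 : x < 1) :
    Summable fun t : ℕ => x ^ (t + 1) / ((t : ℝ) + 1 + i) ^ s := by
  refine Summable.of_nonneg_of_le (fun t => by positivity) (fun t => ?_)
    ((summable_geometric_of_lt_one hx hx1).mul_left x)
  rw [← pow_succ']
  exact div_le_self (pow_nonneg hx _) (one_le_pow₀ (by norm_cast; omega))

/-- Summability of the polylogarithm-type series `∑_k x^{k+1}/(k+1)^s` (the series defining
`polylogSeries s x = L_s(x)`) for `0 ≤ x < 1`, by comparison with the geometric series.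
[folklore] -/
theorem summable_polylogSeries (s : ℕ) {x : ℝ} (hx : 0 ≤ x) (hx1 : x < 1) :
    Summable fun k : ℕ => x ^ (k + 1) / ((k : ℝ) + 1) ^ s := by
  simpa using summable_pow_div_shift s 0 hx hx1

/-- The shifted polylogarithm series: for `0 ≤ x < 1` and `i, s ∈ ℕ`,
`x^i · ∑_{t ≥ 0} x^{t+1}/(t+1+i)^s = L_s(x) − ∑_{k<i} x^{k+1}/(k+1)^s`
(reindex `k = t + i` in `L_s(x) = ∑_{k ≥ 0} x^{k+1}/(k+1)^s`). [folklore] -/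
theorem pow_mul_tsum_shift (s i : ℕ) {x : ℝ} (hx : 0 ≤ x) (hx1 : x < 1) :
    x ^ i * ∑' t : ℕ, x ^ (t + 1) / ((t : ℝ) + 1 + i) ^ s =
      polylogSeries s x - ∑ k ∈ Finset.range i, x ^ (k + 1) / ((k : ℝ) + 1) ^ s := by
  rw [polylogSeries, ← (summable_polylogSeries s hx hx1).sum_add_tsum_nat_add i,
    add_sub_cancel_left, ← tsum_mul_left]
  refine tsum_congr fun t => ?_
  push_cast
  ring

/-- **The Hermite–Padé form at `x = 1/N`** (David–Hirata-Kohno–Kawashima 2020, the computation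
behind Thm 2.1; Hata 1990). If the kernel has the partial fraction expansion
`R_n(t+1) = ∑_{i=0}^{n} (A_{n,i}/(t+1+i)² + B_{n,i}/(t+1+i))` at the integers `t ≥ 0`, then for
every integer `N ≥ 2`
`S_n(1/N) = a_n · L₂(1/N) + b_n · L₁(1/N) + c_n`
with `a_n = formA n N = ∑_i A_{n,i} N^i`, `b_n = formB n N = ∑_i B_{n,i} N^i`,
`c_n = formC n N = −∑_i ∑_{k<i} N^k (A_{n,i}/(i−k)² + B_{n,i}/(i−k))` and `L_s = polylogSeries s`.
[cite: DavidHirataKohnoKawashima2020, Thm 2.1] -/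
theorem form_eq_of_partialFractions {n N : ℕ} (hN : 2 ≤ N)
    (hPF : ∀ t : ℕ, kernel n ((t : ℝ) + 1) =
      ∑ i ∈ Finset.range (n + 1),
        ((coefA n i : ℝ) / ((t : ℝ) + 1 + i) ^ 2 + ((coefB n i : ℚ) : ℝ) / ((t : ℝ) + 1 + i))) :
    form n (1 / (N : ℝ)) =
      (formA n N : ℝ) * polylogSeries 2 (1 / (N : ℝ)) +
        ((formB n N : ℚ) : ℝ) * polylogSeries 1 (1 / (N : ℝ)) + ((formC n N : ℚ) : ℝ) := by
  have hNpos : (0 : ℝ) < N := Nat.cast_pos.mpr (by omega)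
  have hN0 : (N : ℝ) ≠ 0 := hNpos.ne'
  set x : ℝ := 1 / (N : ℝ) with hx
  have hx0 : 0 ≤ x := by positivity
  have hx1 : x < 1 := by
    rw [hx, div_lt_one hNpos]
    exact_mod_cast (by omega : 1 < N)
  have hNx : ∀ j : ℕ, (N : ℝ) ^ j * x ^ j = 1 := fun j => by
    rw [← mul_pow, hx, mul_one_div_cancel hN0, one_pow]
  -- summability of the shifted series and the shift identity solved for the shifted series
  have hS : ∀ s i : ℕ, Summable fun t : ℕ => x ^ (t + 1) / ((t : ℝ) + 1 + i) ^ s :=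
    fun s i => summable_pow_div_shift s i hx0 hx1
  have hg : ∀ s i : ℕ, ∑' t : ℕ, x ^ (t + 1) / ((t : ℝ) + 1 + i) ^ s =
      (N : ℝ) ^ i * (polylogSeries s x - ∑ k ∈ range i, x ^ (k + 1) / ((k : ℝ) + 1) ^ s) := by
    intro s i
    rw [← pow_mul_tsum_shift s i hx0 hx1, ← mul_assoc, hNx, one_mul]
  -- Step 1: expand the kernel by `hPF` and exchange the `tsum` with the finite sum over `i`.
  have h1 : form n x = ∑ i ∈ range (n + 1),
      ((coefA n i : ℝ) * ∑' t : ℕ, x ^ (t + 1) / ((t : ℝ) + 1 + i) ^ 2 +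
        ((coefB n i : ℚ) : ℝ) * ∑' t : ℕ, x ^ (t + 1) / ((t : ℝ) + 1 + i) ^ 1) := by
    have hterm : ∀ t : ℕ, kernel n ((t : ℝ) + 1) * x ^ (t + 1) =
        ∑ i ∈ range (n + 1), ((coefA n i : ℝ) * (x ^ (t + 1) / ((t : ℝ) + 1 + i) ^ 2) +
          ((coefB n i : ℚ) : ℝ) * (x ^ (t + 1) / ((t : ℝ) + 1 + i) ^ 1)) := by
      intro t
      rw [hPF t, Finset.sum_mul]
      refine Finset.sum_congr rfl fun i _ => ?_
      rw [pow_one]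
      ring
    rw [form, tsum_congr hterm, Summable.tsum_finsetSum fun i _ =>
      ((hS 2 i).mul_left (coefA n i : ℝ)).add ((hS 1 i).mul_left ((coefB n i : ℚ) : ℝ))]
    refine Finset.sum_congr rfl fun i _ => ?_
    rw [((hS 2 i).mul_left (coefA n i : ℝ)).tsum_add ((hS 1 i).mul_left ((coefB n i : ℚ) : ℝ)),
      tsum_mul_left, tsum_mul_left]
  -- Step 2: insert the shift identity and reflect the finite remainders (`k ↦ i - 1 - k`).
  have key : ∀ i ∈ range (n + 1),
      (coefA n i : ℝ) * ((N : ℝ) ^ i *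
          (polylogSeries 2 x - ∑ k ∈ range i, x ^ (k + 1) / ((k : ℝ) + 1) ^ 2)) +
        ((coefB n i : ℚ) : ℝ) * ((N : ℝ) ^ i *
          (polylogSeries 1 x - ∑ k ∈ range i, x ^ (k + 1) / ((k : ℝ) + 1) ^ 1)) =
      (coefA n i : ℝ) * (N : ℝ) ^ i * polylogSeries 2 x +
        ((coefB n i : ℚ) : ℝ) * (N : ℝ) ^ i * polylogSeries 1 x -
        ∑ k ∈ range i, (N : ℝ) ^ k *
          ((coefA n i : ℝ) / ((i : ℝ) - k) ^ 2 + ((coefB n i : ℚ) : ℝ) / ((i : ℝ) - k)) := by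
    intro i _
    have hQ : (N : ℝ) ^ i * ((coefA n i : ℝ) * ∑ k ∈ range i, x ^ (k + 1) / ((k : ℝ) + 1) ^ 2 +
        ((coefB n i : ℚ) : ℝ) * ∑ k ∈ range i, x ^ (k + 1) / ((k : ℝ) + 1) ^ 1) =
        ∑ k ∈ range i, (N : ℝ) ^ k *
          ((coefA n i : ℝ) / ((i : ℝ) - k) ^ 2 + ((coefB n i : ℚ) : ℝ) / ((i : ℝ) - k)) := by
      rw [Finset.mul_sum, Finset.mul_sum, ← Finset.sum_add_distrib, Finset.mul_sum,
        ← Finset.sum_range_reflect _ i]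
      refine Finset.sum_congr rfl fun j hj => ?_
      obtain ⟨d, rfl⟩ : ∃ d, i = j + 1 + d :=
        ⟨i - (j + 1), by have := Finset.mem_range.mp hj; omega⟩
      have hcast : ((j + 1 + d : ℕ) : ℝ) - j = (d : ℝ) + 1 := by
        push_cast
        ring
      have hpow : (N : ℝ) ^ (j + 1 + d) * x ^ (d + 1) = (N : ℝ) ^ j := by
        rw [show j + 1 + d = j + (d + 1) by omega, pow_add, mul_assoc, hNx, mul_one]
      rw [show j + 1 + d - 1 - j = d by omega, hcast, ← hpow]
      ring
    linear_combination -hQ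
  rw [h1]
  simp_rw [hg]
  rw [Finset.sum_congr rfl key, Finset.sum_sub_distrib, Finset.sum_add_distrib,
    ← Finset.sum_mul, ← Finset.sum_mul]
  -- Step 3: identify the three coefficients.
  have hA : ((formA n N : ℤ) : ℝ) = ∑ i ∈ range (n + 1), (coefA n i : ℝ) * (N : ℝ) ^ i := by
    push_cast [formA]
    rfl
  have hB : ((formB n N : ℚ) : ℝ) = ∑ i ∈ range (n + 1), ((coefB n i : ℚ) : ℝ) * (N : ℝ) ^ i := by
    push_cast [formB]
    rfl
  have hC : ((formC n N : ℚ) : ℝ) = -∑ i ∈ range (n + 1), ∑ k ∈ range i, (N : ℝ) ^ k *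
      ((coefA n i : ℝ) / ((i : ℝ) - k) ^ 2 + ((coefB n i : ℚ) : ℝ) / ((i : ℝ) - k)) := by
    push_cast [formC]
    rfl
  rw [hA, hB, hC]
  ring

end DilogPade

end Literature.NumberTheory.DiophantineApproximation
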